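import Mathlib
import HarnessLib
import Literature.MathematicalPhysics.QuantumFieldTheory.ConstructiveQFTWave0
import Literature.MathematicalPhysics.QuantumFieldTheory.WilsonFlow

/-!
# Gauge-equivariant flows: the typed notion, closure properties, and the Wilson flow as an instance

HONEST FRAMING: exact (Metropolis-corrected) sampling algorithms for lattice gauge theory;
figures of merit are autocorrelation/cost numbers at stated couplings and volumes; no
continuum-physics claim.

Venture `LatticeQCDFlow` (cell pub-lqcd), topic `Exactness`, FANOUT row 30 (lean-1); the
vocabulary item "gauge-EQUIVARIANCE of a layer as a Prop (pattern `wilsonFlow_gaugeTransform`)"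
of HOME/VENTURE-STATEMENT.md (row `Exactness/FlowPushforward.lean`) and L13 of HOME/THEORY-1.md
§5.  NEW WORK of the cell (definitions + one-line closure lemmas over the tree's
`ConstructiveQFTWave0` / `WilsonFlow`); nothing here is cited as a fact.  Printed counterparts,
named only: Kanwar et al. 2020 and Boyda et al. 2021 (gauge-equivariant coupling layers),
Lüscher 2010 §2.1 (gauge covariance of the flow equation).

## Content (`U : GaugeConfig d L G`, gauge transformations `gaugeTransform g`, `g : Λ → G`)

* (the action laws `gaugeTransform_gaugeTransform` / `gaugeTransform_one` /
  `gaugeTransform_inv_gaugeTransform` are the tree's, in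
  `Literature/MathematicalPhysics/QuantumFieldTheory/FlatLatticeGaugeFields.lean`; not restated);
* `IsGaugeEquivariant F` — `F (U^g) = (F U)^g` for all `g`, `U`; `IsGaugeEquivariant.id/comp` —
  equivariant layers compose (a deep flow of equivariant coupling layers is equivariant);
  `IsGaugeEquivariant.symm` — the inverse of an equivariant bijection is equivariant;
* `IsGaugeInvariant.comp_equivariant` — an invariant functional of an equivariant map is
  invariant: the pulled-back action `S ∘ F`, the model density `(r/J) ∘ F⁻¹` of an equivariant
  flow with invariant prior density and invariant Jacobian (`isGaugeInvariant_modelDensity`),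
  hence the importance weight `w = p/q` and the Metropolis acceptance of `FlowMCMC.lean` /
  `IMHKernel.lean` are gauge invariant (`isGaugeInvariant_weight`) — the sampler cannot break
  gauge symmetry, and per-configuration diagnostics are class functions;
* `isGaugeEquivariant_wilsonFlow` — Lüscher's Wilson flow `V_t` (the leading-order trivializing
  map, the tree's rigorous `wilsonFlow`) is a gauge-equivariant layer for every `t`
  (= the tree's `wilsonFlow_gaugeTransform`).

Not here: equivariance under lattice translations/rotations, and any measure-theoretic use
(Haar invariance of `⊗ Haar` under `gaugeTransform g` is the tree's
`wilsonMeasure_map_gaugeTransform` statement).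
-/

namespace Summit.Ventures.LatticeQCDFlow.Exactness

open Literature.MathematicalPhysics.QuantumFieldTheory

variable {d L : ℕ} {G : Type*} [Group G]

/-! ## Equivariant maps -/

/-- A map of configurations (a flow layer) is GAUGE EQUIVARIANT when it commutes with every
gauge transformation: `F (U^g) = (F U)^g`. -/
def IsGaugeEquivariant (F : GaugeConfig d L G → GaugeConfig d L G) : Prop :=
  ∀ (g : Site d L → G) (U : GaugeConfig d L G), F (gaugeTransform g U) = gaugeTransform g (F U)

/-- The identity layer is equivariant. -/
theorem IsGaugeEquivariant.id : IsGaugeEquivariant (id : GaugeConfig d L G → GaugeConfig d L G) :=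
  fun _ _ => rfl

/-- Equivariant layers compose: a flow built from equivariant coupling layers is equivariant. -/
theorem IsGaugeEquivariant.comp {F F' : GaugeConfig d L G → GaugeConfig d L G}
    (hF : IsGaugeEquivariant F) (hF' : IsGaugeEquivariant F') : IsGaugeEquivariant (F ∘ F') :=
  fun g U => by rw [Function.comp_apply, hF' g U, hF g]; rfl

/-- Iterates of an equivariant layer are equivariant. -/
theorem IsGaugeEquivariant.iterate {F : GaugeConfig d L G → GaugeConfig d L G}
    (hF : IsGaugeEquivariant F) (k : ℕ) : IsGaugeEquivariant F^[k] := by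
  induction k with
  | zero => exact IsGaugeEquivariant.id
  | succ k ih => rw [Function.iterate_succ]; exact ih.comp hF

/-- The inverse of an equivariant bijection is equivariant. -/
theorem IsGaugeEquivariant.symm {F : GaugeConfig d L G ≃ GaugeConfig d L G}
    (hF : IsGaugeEquivariant F) : IsGaugeEquivariant F.symm := by
  intro g U
  apply F.injective
  rw [F.apply_symm_apply, hF g, F.apply_symm_apply]

/-! ## Invariant functionals of equivariant maps -/

/-- A gauge-invariant functional of a gauge-equivariant map is gauge invariant — e.g. the
pulled-back action `S ∘ F` of field-transformed HMC, or any class-function diagnostic of the flow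
output. -/
theorem IsGaugeInvariant.comp_equivariant {α : Type*} {S : GaugeConfig d L G → α}
    {F : GaugeConfig d L G → GaugeConfig d L G} (hS : IsGaugeInvariant S)
    (hF : IsGaugeEquivariant F) : IsGaugeInvariant (S ∘ F) :=
  fun g U => by rw [Function.comp_apply, hF g U, hS g]; rfl

/-- **The model density of an equivariant flow is gauge invariant.**  If the prior density `r`
and the Jacobian `J` are gauge invariant and the (bijective) flow `F` is equivariant, then the
push-forward density `q = (r/J) ∘ F⁻¹` (`FlowPushforward.lean`) is gauge invariant. -/
theorem isGaugeInvariant_modelDensity {β : Type*} [Div β] {r J : GaugeConfig d L G → β}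
    {F : GaugeConfig d L G ≃ GaugeConfig d L G} (hr : IsGaugeInvariant r) (hJ : IsGaugeInvariant J)
    (hF : IsGaugeEquivariant F) : IsGaugeInvariant fun U => r (F.symm U) / J (F.symm U) :=
  fun g U => by dsimp only; rw [hF.symm g U, hr g, hJ g]

/-- **The importance weight `w = p/q` is gauge invariant** when target and model densities are:
so the reweighting factors and the Metropolis acceptance `min {1, w(U')/w(U)}` of flow-based MCMC
are class functions — the exact sampler cannot break gauge symmetry. -/
theorem isGaugeInvariant_weight {β : Type*} [Div β] {p q : GaugeConfig d L G → β}
    (hp : IsGaugeInvariant p) (hq : IsGaugeInvariant q) : IsGaugeInvariant fun U => p U / q U :=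
  fun g U => by dsimp only; rw [hp g U, hq g U]

/-! ## The Wilson flow is an equivariant layer -/

section WilsonFlow

/-- **Lüscher's Wilson flow is gauge equivariant**: `V_t(U^g) = (V_t U)^g` for every flow time `t`
— the tree's `wilsonFlow_gaugeTransform`, read as: the leading-order trivializing map (and each
of its time-steps) is an admissible equivariant layer. -/
theorem isGaugeEquivariant_wilsonFlow {n : ℕ} [NeZero L] (t : ℝ) :
    IsGaugeEquivariant (wilsonFlow t :
      GaugeConfig d L (Matrix.specialUnitaryGroup (Fin n) ℂ) →
        GaugeConfig d L (Matrix.specialUnitaryGroup (Fin n) ℂ)) :=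
  fun g U => wilsonFlow_gaugeTransform g t U

end WilsonFlow

end Summit.Ventures.LatticeQCDFlow.Exactness
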